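import Mathlib
import Summits.Ventures.PercRepro2.Defs
import Summits.Ventures.PercRepro2.Independence
import Summits.Ventures.PercRepro2.Harris
import Summits.Ventures.PercRepro2.Graph
import Summits.Ventures.PercRepro2.Exploration
import Summits.Ventures.PercRepro2.Events
import Summits.Ventures.PercRepro2.Induced
import Summits.Ventures.PercRepro2.BHK
import Summits.Ventures.PercRepro2.BHKEvents
import Summits.Ventures.PercRepro2.OneEdge
import Summits.Ventures.PercRepro2.RBRoot
import Summits.Ventures.PercRepro2.RBRootEdge
import Summits.Ventures.PercRepro2.RBRootEdgePin
import Summits.Ventures.PercRepro2.RBRootEdgeMain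
import Summits.Ventures.PercRepro2.RBRootEdgeT
import Summits.Ventures.PercRepro2.RBDefs
import Summits.Ventures.PercRepro2.RBClubDefs

/-!
# Candidate row 2′RB-CLUB: the root edges at the third vertex can be removed (blind cell
PercRepro2, mine-a g8; MINE-A.md §49, proofs/MINEA-CLUB.md §3)

`Club p ends o b s t w` (`RBClubDefs`) is the coarse inequality
`μ(b ∈ C_s) μ(o ∈ C_s) ≤ μ(w, b, o ∈ C_s) + μ(w ∉ C_s) μ(b ∈ C_s | w ∉ C_s) μ(o ∈ C_s | w ∉ C_s)`
under `μ = P(· | s ↮ t)`, cleared by `P(Q)`. Pinning an edge `e` at the third vertex `w` to a root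
gives an exact two-point decomposition, and for ROOT edges the coarse statement peels off with the
factor `μ(e closed)`:

* `e = {w, s}` (`club_of_update_root`): under `p[e ↦ 1]` the event `{w ∈ C_s}` is sure, so the
  right-hand side is `q · P₁(Q ∩ bL ∩ oL) + (1 − q) · RHS₀`; the left-hand side is a ratio of
  mixtures, bounded by the mixture of ratios (`RBRootEdge.mix_same`) because both first-moment
  shifts `μ₁(bL) − μ₀(bL)`, `μ₁(oL) − μ₀(oL)` are `≥ 0` (`RBRootEdge.mono_root`, BHK06 Thm 1.5);
  the forced ratio `P₁(Q ∩ bL) P₁(Q ∩ oL) / P₁(Q)` is at most `P₁(Q ∩ bL ∩ oL)` (BHK 1.3 on the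
  merged graph, `bhk_same_cluster_events`). The coarse σ-algebra absorbs the edge bit exactly.
* `e = {w, t}` (`club_of_update_root_t`): under `p[e ↦ 1]` the event `{w ∈ C_s}` is null, and
  `P₁(Q ∩ X) = P₀(Q ∩ {w ∉ C_s} ∩ X)` (`RBRootEdge.prob_update_one_conn_root_t`): the avoided
  masses are the SAME on both branches (the edge `{w, t}` is independent of `C_s` given
  `s ↮ {t, w}`), so the refinement term vanishes; the shifts are both `≤ 0`
  (`RBRootEdge.mono_root_t`, BHK 1.3) and `mix_same` closes the case.

`Club_of_update_root_edge` / `Club_of_zero_roots` / `Club_of_no_root_edges` iterate: the coarse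
row at `w` follows from the coarse row at `w` with every edge between `w` and `{s, t}` deleted.
With MINE-A.md §48 (the two-marker star, a polynomial certificate from BHK 1.3 on `G − w`) this is
the paper proof of **2′RB-CLUB-K**: `Club` holds at every KERNEL third vertex (`N(w) ⊆ {s,t,b,o}`).
No statement here is restricted to kernel vertices: the peeling is valid at every third vertex.
-/

namespace Summit.Ventures.PercRepro2

namespace RBClubRoot

open scoped Classical

section Forced

variable {V : Type*} {E : Type*} [Fintype E] [DecidableEq E] [Fintype V] {R : Type*} [Field R]
  [LinearOrder R] [IsStrictOrderedRing R] (p : E → R) (ends : E → Sym2 V) (s t w : V) {e : E}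

omit [Fintype E] [DecidableEq E] [Fintype V] [Field R] [LinearOrder R] [IsStrictOrderedRing R] in
/-- `{u ↔ v} = {v ↔ u}`. -/
lemma connEvent_comm (u v : V) : connEvent ends u v = connEvent ends v u := by
  ext ω
  exact ⟨conn_symm, conn_symm⟩

omit [Fintype V] [LinearOrder R] [IsStrictOrderedRing R] in
/-- Under `p[e ↦ 1]` with `e = {w, s}` the event `{s ↔ w}` is sure: `P₁(Z ∩ {s ↔ w}ᶜ) = 0`. -/
lemma prob_update_one_inter_compl_conn (hends : ends e = s(w, s)) (Z : Set (Config E)) :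
    prob (Function.update p e 1) (Z ∩ (connEvent ends s w)ᶜ) = 0 := by
  rw [← prob_update_one_inter_openEdge]
  have h : Z ∩ (connEvent ends s w)ᶜ ∩ openEdge e = ∅ := by
    refine Set.eq_empty_iff_forall_notMem.2 fun ω hω => ?_
    obtain ⟨⟨_, hns⟩, he⟩ := hω
    exact hns (conn_symm (conn_of_openAdj ⟨e, he, hends⟩))
  rw [h, prob_empty]

omit [Fintype V] [LinearOrder R] [IsStrictOrderedRing R] in
/-- The same with a further intersection: `P₁(Z ∩ {s ↔ w}ᶜ ∩ X) = 0` (`e = {w, s}`). -/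
lemma prob_update_one_inter_compl_conn_inter (hends : ends e = s(w, s)) (Z X : Set (Config E)) :
    prob (Function.update p e 1) (Z ∩ (connEvent ends s w)ᶜ ∩ X) = 0 := by
  rw [Set.inter_right_comm]
  exact prob_update_one_inter_compl_conn p ends s w hends (Z ∩ X)

omit [Fintype V] [LinearOrder R] [IsStrictOrderedRing R] in
/-- Under `p[e ↦ 1]` with `e = {w, s}` the event `{s ↔ w}` can be dropped:
`P₁(Z ∩ {s ↔ w} ∩ X ∩ Y) = P₁(Z ∩ X ∩ Y)`. -/
lemma prob_update_one_inter_conn (hends : ends e = s(w, s)) (Z X Y : Set (Config E)) :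
    prob (Function.update p e 1) (Z ∩ connEvent ends s w ∩ X ∩ Y) =
      prob (Function.update p e 1) (Z ∩ X ∩ Y) := by
  rw [← prob_update_one_inter_openEdge, ← prob_update_one_inter_openEdge p (Z ∩ X ∩ Y)]
  congr 1
  ext ω
  simp only [Set.mem_inter_iff, mem_connEvent, mem_openEdge]
  constructor
  · rintro ⟨⟨⟨⟨hZ, _⟩, hX⟩, hY⟩, he⟩
    exact ⟨⟨⟨hZ, hX⟩, hY⟩, he⟩
  · rintro ⟨⟨⟨hZ, hX⟩, hY⟩, he⟩
    exact ⟨⟨⟨⟨hZ, conn_symm (conn_of_openAdj ⟨e, he, hends⟩)⟩, hX⟩, hY⟩, he⟩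

omit [Fintype V] [LinearOrder R] [IsStrictOrderedRing R] in
/-- Under `p[e ↦ 1]` with `e = {w, t}` the event `{s ↮ t} ∩ {s ↔ w}` is null. -/
lemma prob_update_one_compl_inter_conn_t (hends : ends e = s(w, t)) (X Y : Set (Config E)) :
    prob (Function.update p e 1) ((connEvent ends s t)ᶜ ∩ connEvent ends s w ∩ X ∩ Y) = 0 := by
  rw [← prob_update_one_inter_openEdge]
  have h : (connEvent ends s t)ᶜ ∩ connEvent ends s w ∩ X ∩ Y ∩ openEdge e = ∅ := by
    refine Set.eq_empty_iff_forall_notMem.2 fun ω hω => ?_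
    obtain ⟨⟨⟨⟨hQ, hsw⟩, _⟩, _⟩, he⟩ := hω
    exact hQ (conn_trans hsw (conn_of_openAdj ⟨e, he, hends⟩))
  rw [h, prob_empty]

omit [Fintype V] [LinearOrder R] [IsStrictOrderedRing R] in
/-- Under `p[e ↦ 1]` with `e = {w, t}` the event `{s ↔ w}ᶜ` can be dropped on `{s ↮ t}`:
`P₁(Q ∩ {s ↔ w}ᶜ ∩ X) = P₁(Q ∩ X)`. -/
lemma prob_update_one_compl_inter_compl_conn_t (hends : ends e = s(w, t)) (X : Set (Config E)) :
    prob (Function.update p e 1) ((connEvent ends s t)ᶜ ∩ (connEvent ends s w)ᶜ ∩ X) =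
      prob (Function.update p e 1) ((connEvent ends s t)ᶜ ∩ X) := by
  rw [← prob_update_one_inter_openEdge,
    ← prob_update_one_inter_openEdge p ((connEvent ends s t)ᶜ ∩ X)]
  congr 1
  ext ω
  simp only [Set.mem_inter_iff, Set.mem_compl_iff, mem_connEvent, mem_openEdge]
  constructor
  · rintro ⟨⟨⟨hQ, _⟩, hX⟩, he⟩
    exact ⟨⟨hQ, hX⟩, he⟩
  · rintro ⟨⟨hQ, hX⟩, he⟩
    exact ⟨⟨⟨hQ, fun hsw => hQ (conn_trans hsw (conn_of_openAdj ⟨e, he, hends⟩))⟩, hX⟩, he⟩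

omit [Fintype V] [LinearOrder R] [IsStrictOrderedRing R] in
/-- Under `p[e ↦ 1]` with `e = {w, t}`: `P₁(Q ∩ {s ↔ w}ᶜ) = P₁(Q)`. -/
lemma prob_update_one_compl_inter_compl_conn_t' (hends : ends e = s(w, t)) :
    prob (Function.update p e 1) ((connEvent ends s t)ᶜ ∩ (connEvent ends s w)ᶜ) =
      prob (Function.update p e 1) (connEvent ends s t)ᶜ := by
  have h := prob_update_one_compl_inter_compl_conn_t p ends s t w hends Set.univ
  simpa only [Set.inter_univ] using h

variable {p}

/-- **BHK 1.3 under `p[e ↦ 1]`**, cleared: `P₁(Q ∩ bL) P₁(Q ∩ oL) ≤ P₁(Q ∩ bL ∩ oL) P₁(Q)`. -/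
lemma bhk_same_update_one (hp : IsProbVec p) (b o : V) :
    prob (Function.update p e 1) ((connEvent ends s t)ᶜ ∩ connEvent ends b s) *
        prob (Function.update p e 1) ((connEvent ends s t)ᶜ ∩ connEvent ends o s) ≤
      prob (Function.update p e 1) ((connEvent ends s t)ᶜ ∩ connEvent ends b s ∩ connEvent ends o s) *
        prob (Function.update p e 1) (connEvent ends s t)ᶜ := by
  have hp1 : IsProbVec (Function.update p e 1) := hp.update e zero_le_one le_rfl
  have key := bhk_same_cluster_events (Function.update p e 1) hp1 ends s t
    (RBRoot.isUpperSet_mem b) (RBRoot.isUpperSet_mem o)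
  rw [← RBRoot.connEvent_eq_clusterInEvent_right ends b s,
    ← RBRoot.connEvent_eq_clusterInEvent_right ends o s] at key
  have e1 : connEvent ends b s ∩ (connEvent ends s t)ᶜ =
      (connEvent ends s t)ᶜ ∩ connEvent ends b s := Set.inter_comm _ _
  have e2 : connEvent ends o s ∩ (connEvent ends s t)ᶜ =
      (connEvent ends s t)ᶜ ∩ connEvent ends o s := Set.inter_comm _ _
  have e3 : connEvent ends b s ∩ connEvent ends o s ∩ (connEvent ends s t)ᶜ =
      (connEvent ends s t)ᶜ ∩ connEvent ends b s ∩ connEvent ends o s := by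
    ext ω; simp only [Set.mem_inter_iff]; tauto
  rw [e1, e2, e3] at key
  exact key

end Forced

section Mixture

variable {R : Type*} [Field R] [LinearOrder R] [IsStrictOrderedRing R]

/-- A forced ratio is bounded by the BHK mass: `a c / z ≤ j` from `a c ≤ j z`, `0 ≤ a ≤ z`. -/
lemma div_le_of_bhk {a c z j : R} (ha : 0 ≤ a) (haz : a ≤ z) (hj : 0 ≤ j)
    (h : a * c ≤ j * z) : a * c / z ≤ j := by
  rcases eq_or_lt_of_le (ha.trans haz) with hz | hz
  · have ha' : a = 0 := le_antisymm (hz ▸ haz) ha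
    rw [← hz, ha', zero_mul, zero_div]
    exact hj
  · rw [div_le_iff₀ hz]
    exact h

omit [LinearOrder R] [IsStrictOrderedRing R] in
/-- Scaling a ratio: `(c x)(c y) / (c n) = c · (x y / n)` (also for `c = 0`). -/
lemma scaled_ratio (c x y n : R) : (c * x) * (c * y) / (c * n) = c * (x * y / n) := by
  rcases eq_or_ne c 0 with hc | hc
  · subst hc; simp
  · rw [show (c * x) * (c * y) = c * (c * (x * y)) by ring, mul_div_mul_left _ _ hc, mul_div_assoc]

/-- **The coarse two-point step at a root edge `{w, s}`**: with `0 ≤ aᵢ ≤ zᵢ`, `0 ≤ cᵢ ≤ zᵢ`,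
the shifts of the same sign, BHK `a₁ c₁ ≤ j₁ z₁` on the forced branch and the coarse row on the
closed branch, the ratio of mixtures is at most the mixed right-hand side. -/
lemma club_mix_root {q a0 a1 c0 c1 z0 z1 j1 m0 x0 y0 n0 : R} (hq0 : 0 ≤ q) (hq1 : q ≤ 1)
    (ha0 : 0 ≤ a0) (ha0z : a0 ≤ z0) (ha1 : 0 ≤ a1) (ha1z : a1 ≤ z1) (hc0 : 0 ≤ c0) (hc0z : c0 ≤ z0)
    (hc1 : 0 ≤ c1) (hc1z : c1 ≤ z1) (hAC : 0 ≤ (a1 * z0 - a0 * z1) * (c1 * z0 - c0 * z1))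
    (hj1 : 0 ≤ j1) (hbhk : a1 * c1 ≤ j1 * z1) (h0 : a0 * c0 / z0 ≤ m0 + x0 * y0 / n0) :
    (q * a1 + (1 - q) * a0) * (q * c1 + (1 - q) * c0) / (q * z1 + (1 - q) * z0) ≤
      (q * j1 + (1 - q) * m0) +
        ((1 - q) * x0) * ((1 - q) * y0) / ((1 - q) * n0) := by
  have hmix := RBRootEdge.mix_same hq0 hq1 ha0 ha0z ha1 ha1z hc0 hc0z hc1 hc1z hAC
  have h1 : a1 * c1 / z1 ≤ j1 := div_le_of_bhk ha1 ha1z hj1 hbhk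
  rw [scaled_ratio]
  have hq1' : 0 ≤ 1 - q := sub_nonneg.2 hq1
  calc (q * a1 + (1 - q) * a0) * (q * c1 + (1 - q) * c0) / (q * z1 + (1 - q) * z0)
      ≤ q * (a1 * c1 / z1) + (1 - q) * (a0 * c0 / z0) := hmix
    _ ≤ q * j1 + (1 - q) * (m0 + x0 * y0 / n0) :=
        add_le_add (mul_le_mul_of_nonneg_left h1 hq0) (mul_le_mul_of_nonneg_left h0 hq1')
    _ = (q * j1 + (1 - q) * m0) + (1 - q) * (x0 * y0 / n0) := by ring

/-- **The coarse two-point step at a root edge `{w, t}`**: the forced masses `a₁, c₁, z₁` are the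
avoided masses of the closed branch (`x₀ = a₁`, `y₀ = c₁`, `n₀ = z₁`), so the refinement term
vanishes and the closed-branch coarse row mixes exactly. -/
lemma club_mix_root_t {q a0 a1 c0 c1 z0 z1 m0 x0 y0 n0 : R} (hq0 : 0 ≤ q) (hq1 : q ≤ 1)
    (ha0 : 0 ≤ a0) (ha0z : a0 ≤ z0) (ha1 : 0 ≤ a1) (ha1z : a1 ≤ z1) (hc0 : 0 ≤ c0) (hc0z : c0 ≤ z0)
    (hc1 : 0 ≤ c1) (hc1z : c1 ≤ z1) (hAC : 0 ≤ (a1 * z0 - a0 * z1) * (c1 * z0 - c0 * z1))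
    (hx : x0 = a1) (hy : y0 = c1) (hn : n0 = z1) (h0 : a0 * c0 / z0 ≤ m0 + x0 * y0 / n0) :
    (q * a1 + (1 - q) * a0) * (q * c1 + (1 - q) * c0) / (q * z1 + (1 - q) * z0) ≤
      (q * 0 + (1 - q) * m0) +
        (q * a1 + (1 - q) * x0) * (q * c1 + (1 - q) * y0) / (q * z1 + (1 - q) * n0) := by
  rw [hx, hy, hn] at h0 ⊢
  have hmix := RBRootEdge.mix_same hq0 hq1 ha0 ha0z ha1 ha1z hc0 hc0z hc1 hc1z hAC
  have hq1' : 0 ≤ 1 - q := sub_nonneg.2 hq1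
  have e1 : q * a1 + (1 - q) * a1 = a1 := by ring
  have e2 : q * c1 + (1 - q) * c1 = c1 := by ring
  have e3 : q * z1 + (1 - q) * z1 = z1 := by ring
  rw [e1, e2, e3]
  calc (q * a1 + (1 - q) * a0) * (q * c1 + (1 - q) * c0) / (q * z1 + (1 - q) * z0)
      ≤ q * (a1 * c1 / z1) + (1 - q) * (a0 * c0 / z0) := hmix
    _ ≤ q * (a1 * c1 / z1) + (1 - q) * (m0 + a1 * c1 / z1) :=
        add_le_add le_rfl (mul_le_mul_of_nonneg_left h0 hq1')
    _ = (q * 0 + (1 - q) * m0) + a1 * c1 / z1 := by ring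

end Mixture

section Main

variable {V : Type*} {E : Type*} [Fintype E] [DecidableEq E] [Fintype V] [DecidableEq V]
  {R : Type*} [Field R] [LinearOrder R] [IsStrictOrderedRing R] (ends : E → Sym2 V) {p : E → R}
  {e : E}

omit [DecidableEq V] in
/-- **The edge to the root `s` can be removed from the coarse row.** For `e = {w, s}`,
`Club p` follows from `Club p[e ↦ 0]`. -/
theorem club_of_update_root (hp : IsProbVec p) {s t w o b : V} (hends : ends e = s(w, s))
    (h0 : RB.Club (Function.update p e 0) ends o b s t w) : RB.Club p ends o b s t w := by
  have hp0 : IsProbVec (Function.update p e 0) := hp.update e le_rfl zero_le_one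
  have hp1 : IsProbVec (Function.update p e 1) := hp.update e zero_le_one le_rfl
  unfold RB.Club RB.Qst at h0 ⊢
  rw [prob_eq_pin p ((connEvent ends s t)ᶜ ∩ connEvent ends b s) e,
    prob_eq_pin p ((connEvent ends s t)ᶜ ∩ connEvent ends o s) e,
    prob_eq_pin p (connEvent ends s t)ᶜ e,
    prob_eq_pin p ((connEvent ends s t)ᶜ ∩ connEvent ends s w ∩ connEvent ends b s ∩
      connEvent ends o s) e,
    prob_eq_pin p ((connEvent ends s t)ᶜ ∩ (connEvent ends s w)ᶜ ∩ connEvent ends b s) e,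
    prob_eq_pin p ((connEvent ends s t)ᶜ ∩ (connEvent ends s w)ᶜ ∩ connEvent ends o s) e,
    prob_eq_pin p ((connEvent ends s t)ᶜ ∩ (connEvent ends s w)ᶜ) e,
    prob_update_one_inter_conn p ends s w hends,
    prob_update_one_inter_compl_conn_inter p ends s w hends,
    prob_update_one_inter_compl_conn_inter p ends s w hends,
    prob_update_one_inter_compl_conn p ends s w hends]
  simp only [mul_zero, zero_add]
  exact club_mix_root (hp.nonneg e) (hp.le_one e) (prob_nonneg hp0 _)
    (prob_mono hp0 Set.inter_subset_left) (prob_nonneg hp1 _) (prob_mono hp1 Set.inter_subset_left)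
    (prob_nonneg hp0 _) (prob_mono hp0 Set.inter_subset_left) (prob_nonneg hp1 _)
    (prob_mono hp1 Set.inter_subset_left)
    (mul_nonneg (sub_nonneg.2 (RBRootEdge.mono_root ends s t w hp hends b))
      (sub_nonneg.2 (RBRootEdge.mono_root ends s t w hp hends o)))
    (prob_nonneg hp1 _) (bhk_same_update_one ends s t hp b o) h0

omit [DecidableEq V] in
/-- **The edge to the other root `t` can be removed from the coarse row.** For `e = {w, t}`,
`Club p` follows from `Club p[e ↦ 0]`. -/
theorem club_of_update_root_t (hp : IsProbVec p) {s t w o b : V} (hends : ends e = s(w, t))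
    (h0 : RB.Club (Function.update p e 0) ends o b s t w) : RB.Club p ends o b s t w := by
  have hp0 : IsProbVec (Function.update p e 0) := hp.update e le_rfl zero_le_one
  have hp1 : IsProbVec (Function.update p e 1) := hp.update e zero_le_one le_rfl
  -- the forced masses are the avoided masses of the closed branch
  have hx : prob (Function.update p e 1) ((connEvent ends s t)ᶜ ∩ connEvent ends b s) =
      prob (Function.update p e 0) ((connEvent ends s t)ᶜ ∩ (connEvent ends s w)ᶜ ∩
        connEvent ends b s) := by
    rw [RBRootEdge.prob_update_one_conn_root_t p ends s t w hends b, connEvent_comm ends w s,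
      Set.inter_right_comm]
  have hy : prob (Function.update p e 1) ((connEvent ends s t)ᶜ ∩ connEvent ends o s) =
      prob (Function.update p e 0) ((connEvent ends s t)ᶜ ∩ (connEvent ends s w)ᶜ ∩
        connEvent ends o s) := by
    rw [RBRootEdge.prob_update_one_conn_root_t p ends s t w hends o, connEvent_comm ends w s,
      Set.inter_right_comm]
  have hn : prob (Function.update p e 1) (connEvent ends s t)ᶜ =
      prob (Function.update p e 0) ((connEvent ends s t)ᶜ ∩ (connEvent ends s w)ᶜ) := by
    rw [RBRootEdge.prob_update_one_compl_t p ends s t w hends, connEvent_comm ends w s]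
  have hAC := mul_nonneg (neg_nonneg.2 (sub_nonpos.2 (RBRootEdge.mono_root_t ends s t w hp hends b)))
    (neg_nonneg.2 (sub_nonpos.2 (RBRootEdge.mono_root_t ends s t w hp hends o)))
  rw [neg_mul_neg] at hAC
  unfold RB.Club RB.Qst at h0 ⊢
  rw [prob_eq_pin p ((connEvent ends s t)ᶜ ∩ connEvent ends b s) e,
    prob_eq_pin p ((connEvent ends s t)ᶜ ∩ connEvent ends o s) e,
    prob_eq_pin p (connEvent ends s t)ᶜ e,
    prob_eq_pin p ((connEvent ends s t)ᶜ ∩ connEvent ends s w ∩ connEvent ends b s ∩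
      connEvent ends o s) e,
    prob_eq_pin p ((connEvent ends s t)ᶜ ∩ (connEvent ends s w)ᶜ ∩ connEvent ends b s) e,
    prob_eq_pin p ((connEvent ends s t)ᶜ ∩ (connEvent ends s w)ᶜ ∩ connEvent ends o s) e,
    prob_eq_pin p ((connEvent ends s t)ᶜ ∩ (connEvent ends s w)ᶜ) e,
    prob_update_one_compl_inter_conn_t p ends s t w hends,
    prob_update_one_compl_inter_compl_conn_t p ends s t w hends,
    prob_update_one_compl_inter_compl_conn_t p ends s t w hends,
    prob_update_one_compl_inter_compl_conn_t' p ends s t w hends]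
  exact club_mix_root_t (hp.nonneg e) (hp.le_one e) (prob_nonneg hp0 _)
    (prob_mono hp0 Set.inter_subset_left) (prob_nonneg hp1 _) (prob_mono hp1 Set.inter_subset_left)
    (prob_nonneg hp0 _) (prob_mono hp0 Set.inter_subset_left) (prob_nonneg hp1 _)
    (prob_mono hp1 Set.inter_subset_left) hAC hx.symm hy.symm hn.symm h0

omit [DecidableEq V] in
/-- **One root edge at `w` can be removed (typed)**: `Club p` from `Club p[g ↦ 0]` for `g` an edge
from `w` to a root. -/
theorem Club_of_update_root_edge (hp : IsProbVec p) (o b s t w : V) {g : E}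
    (hg : ends g = s(w, s) ∨ ends g = s(w, t))
    (h : RB.Club (Function.update p g 0) ends o b s t w) : RB.Club p ends o b s t w := by
  rcases hg with hgs | hgt
  · exact club_of_update_root ends hp hgs h
  · exact club_of_update_root_t ends hp hgt h

omit [DecidableEq V] in
/-- **A finite set of root edges at `w` can be removed (typed).** -/
theorem Club_of_zero_roots (hp : IsProbVec p) (o b s t w : V) (F : Finset E)
    (hF : ∀ e ∈ F, ends e = s(w, s) ∨ ends e = s(w, t))
    (h : RB.Club (fun e => if e ∈ F then 0 else p e) ends o b s t w) :
    RB.Club p ends o b s t w := by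
  induction F using Finset.induction_on with
  | empty =>
    simpa using h
  | insert a F ha ih =>
    refine ih (fun e he => hF e (Finset.mem_insert_of_mem he)) ?_
    have hpF : IsProbVec (fun e => if e ∈ F then 0 else p e) :=
      ⟨fun e => by split_ifs; exacts [le_rfl, hp.nonneg e],
       fun e => by split_ifs; exacts [zero_le_one, hp.le_one e]⟩
    have heq : (fun e => if e ∈ insert a F then 0 else p e) =
        Function.update (fun e => if e ∈ F then 0 else p e) a 0 := by
      funext e
      by_cases h' : e = a
      · subst h'; simp
      · rw [Function.update_of_ne h']; simp [h']
    rw [heq] at h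
    exact Club_of_update_root_edge ends hpF o b s t w (hF a (Finset.mem_insert_self a F)) h

/-- **Every root edge at `w` can be removed (typed)**: the coarse row at `p` follows from the
coarse row at the weight vector in which every edge between `w` and `{s, t}` has weight `0`. -/
theorem Club_of_no_root_edges (hp : IsProbVec p) (o b s t w : V)
    (h : RB.Club (fun e => if ends e = s(w, s) ∨ ends e = s(w, t) then 0 else p e)
      ends o b s t w) : RB.Club p ends o b s t w := by
  set F : Finset E := Finset.univ.filter (fun e => ends e = s(w, s) ∨ ends e = s(w, t)) with hF
  have hFmem : ∀ e ∈ F, ends e = s(w, s) ∨ ends e = s(w, t) :=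
    fun e he => (Finset.mem_filter.1 he).2
  have heq : (fun e => if ends e = s(w, s) ∨ ends e = s(w, t) then 0 else p e) =
      (fun e => if e ∈ F then 0 else p e) := by
    funext e
    simp only [hF, Finset.mem_filter, Finset.mem_univ, true_and]
  rw [heq] at h
  exact Club_of_zero_roots ends hp o b s t w F hFmem h

end Main

end RBClubRoot

end Summit.Ventures.PercRepro2
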